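import Mathlib
import HarnessLib
import Summits.Ventures.LatticeQCDFlow.Exactness.GaugeFTHMCSymmetricWord
import Summits.Ventures.LatticeQCDFlow.Exactness.SU2MaskedKickLayer

/-!
# FT-HMC on the `SU(2)` rung with the engine's OMF2 / OMF4 integrators is exact (any certified layer; the masked kick layers)

HONEST FRAMING: exact (Metropolis-corrected) sampling algorithms for lattice gauge theory;
figures of merit are autocorrelation/cost numbers at stated couplings and volumes; no
continuum-physics claim.

Venture `LatticeQCDFlow` (cell pub-lqcd), topic `Exactness`; FANOUT row 14 (`eng-flowhmc`, engine
`latflow.fthmc`, family B; `dynamics.Dynamics(integrator = "omf2" | "omf4")`).  NEW WORK of the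
cell; nothing is cited as a fact; no number.  `GaugeFTHMCSymmetricWord.lean` (row 14, GEN-6)
proved gauge-link FT-HMC exact for ANY palindromic splitting word and packaged OMF2 on the U(1)
rung; the `SU(2)` rung (`SU2WilsonFlowLOMember.lean`, `SU2MaskedKickLayer.lean`) was typed with
the leapfrog only.  This file closes the integrator menu on the `SU(2)` rung, for the quaternion
exponential drift(s) and Gaussian momenta `(Edge × Fin 3) → ℝ`:

* `omf4Stages_measurable`, `measurable_flip_omf4Word_pow` — measurability packaging of the OMF4
  word with group drifts (the OMF2 analogue is GEN-6's `measurable_flip_omf2Word_pow`);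
* **`su2_fthmc_omf2_gaussian_exact`**, **`su2_fthmc_omf4_gaussian_exact`** — for ANY certified
  layer `(F, J)` of `GaugeConfig d L SU(2)` (measurable equivalence, positive measurable Haar
  Jacobian) and every measurable action: refresh → `n` steps of OMF2 (`K_{g₁} D_c K_{g₂} D_c K_{g₁}`,
  any two measurable forces) / OMF4 (11 stages, any three forces, drifts with any three constants
  `c₁ c₂ c₃`) → flip → Metropolis on the pulled-back Hamiltonian → forget → report leaves
  `e^{−S} · ⊗_e haarProbability SU(2)` invariant (`gauge_fthmc_omf2_config_exact` /
  `gauge_fthmc_omf4_config_exact` with `su2Drift_neg`, `measurable_su2Drift`);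
* **`su2_fthmc_omf2_gaussian_exact_maskedKick`**, **`su2_fthmc_omf4_gaussian_exact_maskedKick`** —
  the same through any masked `SU(2)` kick layer driven by a frozen measurable field inside its
  refusal rule (LO Wilson-flow sub-step, learned residual layers): the layer exists as a measurable
  equivalence with the engine's formula (`exists_measurableEquiv_su2MaskedKick`) and the OMF
  kernels through it are exact.

NOT CLAIMED: orders of accuracy of the integrators (irrelevant to exactness); ergodicity;
`SU(N ≥ 3)`; any number.
-/

noncomputable section

namespace Summit.Ventures.LatticeQCDFlow.Exactness

open Real Set MeasureTheory Measure InnerProductGeometry Metric WithLp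
open Literature.MathematicalPhysics.QuantumFieldTheory Summit.Ventures.LatticeQCDFlow.Theory2
open ProbabilityTheory ProbabilityTheory.Kernel
open scoped ENNReal Matrix

/-! ## Measurability of the OMF4 word with group drifts -/

section Measurability

variable {Q P : Type*} [MeasurableSpace Q] [MeasurableSpace P] [AddCommGroup P]
  [Group Q] [MeasurableMul₂ Q] [MeasurableAdd₂ P]

/-- The outer stages `[K_{gᵥ}, D_{e₁}, K_{gₗ}, D_{e₂}, K_{g_c}]` of the OMF4 word with group drifts
are measurable. -/
theorem omf4Stages_measurable {e₁ e₂ : P → Q} (hem₁ : Measurable e₁) (hem₂ : Measurable e₂)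
    {gᵥ gₗ g_c : Q → P} (hgᵥ : Measurable gᵥ) (hgₗ : Measurable gₗ) (hg_c : Measurable g_c) :
    ∀ A ∈ [kick gᵥ, drift (mulDrift e₁), kick gₗ, drift (mulDrift e₂), kick g_c], Measurable (⇑A) := by
  intro A hA
  simp only [List.mem_cons, List.mem_nil_iff, or_false] at hA
  rcases hA with rfl | rfl | rfl | rfl | rfl
  · exact measurable_kick hgᵥ
  · exact measurable_drift (measurable_mulDrift hem₁)
  · exact measurable_kick hgₗ
  · exact measurable_drift (measurable_mulDrift hem₂)
  · exact measurable_kick hg_c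

variable [MeasurableNeg P]

/-- `flip ∘ (OMF4 word)^n` with group drifts is measurable. -/
theorem measurable_flip_omf4Word_pow {e₁ e₂ e₃ : P → Q} (hem₁ : Measurable e₁) (hem₂ : Measurable e₂)
    (hem₃ : Measurable e₃) {gᵥ gₗ g_c : Q → P} (hgᵥ : Measurable gᵥ) (hgₗ : Measurable gₗ)
    (hg_c : Measurable g_c) (n : ℕ) :
    Measurable (⇑((flip : Equiv.Perm (Q × P)) *
      omf4Word gᵥ (mulDrift e₁) gₗ (mulDrift e₂) g_c (mulDrift e₃) ^ n)) :=
  measurable_flip_palindromicWord_pow_of_measurable (omf4Stages_measurable hem₁ hem₂ hgᵥ hgₗ hg_c)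
    (measurable_drift (measurable_mulDrift hem₃)) n

end Measurability

/-! ## The `SU(2)` rung: any certified layer -/

section SU2

variable {d L : ℕ} [NeZero L]

/-- **FT-HMC on the `SU(2)` rung with the engine's OMF2 integrator is exact.**  Any certified layer
`(F, J)`; Gaussian momenta; the word `K_{g₁} D_c K_{g₂} D_c K_{g₁}` with the quaternion exponential
drift (constant `c`) and ANY two measurable forces, `n` steps; flip; Metropolis on the pulled-back
Hamiltonian; forget; report through `F`. -/
theorem su2_fthmc_omf2_gaussian_exact
    {F : GaugeConfig d L (Matrix.specialUnitaryGroup (Fin 2) ℂ) ≃ᵐ GaugeConfig d L (Matrix.specialUnitaryGroup (Fin 2) ℂ)} {J : GaugeConfig d L (Matrix.specialUnitaryGroup (Fin 2) ℂ) → ℝ}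
    (hJ : ∀ V, 0 < J V) (hJm : Measurable J)
    (hF : HasJacobian (Measure.pi fun _ : Edge d L => haarProbability (Matrix.specialUnitaryGroup (Fin 2) ℂ)) F
      fun V => ENNReal.ofReal (J V))
    {S : GaugeConfig d L (Matrix.specialUnitaryGroup (Fin 2) ℂ) → ℝ} (hS : Measurable S) (c : ℝ)
    {g₁ g₂ : GaugeConfig d L (Matrix.specialUnitaryGroup (Fin 2) ℂ) → ((Edge d L × Fin 3) → ℝ)} (hg₁ : Measurable g₁) (hg₂ : Measurable g₂) (n : ℕ) :
    Invariant
      (conjKernel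
        (refreshUpdate
          (involMH
            (⇑((flip : Equiv.Perm (GaugeConfig d L (Matrix.specialUnitaryGroup (Fin 2) ℂ) × ((Edge d L × Fin 3) → ℝ))) *
                omf2Word g₁ (mulDrift fun q : (Edge d L × Fin 3) → ℝ =>
                    fun ℓ : Edge d L => gaussUnit (toLp 2
          ![Real.cos (c * Real.sqrt (q (ℓ, 0) ^ 2 + q (ℓ, 1) ^ 2 + q (ℓ, 2) ^ 2)),
            c * Real.sinc (c * Real.sqrt (q (ℓ, 0) ^ 2 + q (ℓ, 1) ^ 2 + q (ℓ, 2) ^ 2)) * q (ℓ, 0),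
            c * Real.sinc (c * Real.sqrt (q (ℓ, 0) ^ 2 + q (ℓ, 1) ^ 2 + q (ℓ, 2) ^ 2)) * q (ℓ, 1),
            c * Real.sinc (c * Real.sqrt (q (ℓ, 0) ^ 2 + q (ℓ, 1) ^ 2 + q (ℓ, 2) ^ 2)) * q (ℓ, 2)])) g₂ ^ n))
            (measurable_flip_omf2Word_pow (measurable_su2Drift c) hg₁ hg₂ n)
            fun z : GaugeConfig d L (Matrix.specialUnitaryGroup (Fin 2) ℂ) × ((Edge d L × Fin 3) → ℝ) => (S (F z.1) - Real.log (J z.1)) + ∑ i, z.2 i ^ 2 / 2)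
          ((((volume : Measure ((Edge d L × Fin 3) → ℝ)).withDensity
                  fun q => ENNReal.ofReal (Real.exp (-(∑ i, q i ^ 2 / 2)))) Set.univ)⁻¹ •
              (volume : Measure ((Edge d L × Fin 3) → ℝ)).withDensity
                fun q => ENNReal.ofReal (Real.exp (-(∑ i, q i ^ 2 / 2)))))
        F)
      ((Measure.pi fun _ : Edge d L => haarProbability (Matrix.specialUnitaryGroup (Fin 2) ℂ)).withDensity
          fun U => ENNReal.ofReal (Real.exp (-S U))) := by
  haveI := isNegInvariant_volume_pi (Λ := Edge d L × Fin 3)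
  exact gauge_fthmc_omf2_config_exact
    (μ := Measure.pi fun _ : Edge d L => haarProbability (Matrix.specialUnitaryGroup (Fin 2) ℂ))
    (ν := (volume : Measure ((Edge d L × Fin 3) → ℝ))) (F := F) (J := J)
    (e := fun q : (Edge d L × Fin 3) → ℝ =>
                    fun ℓ : Edge d L => gaussUnit (toLp 2
          ![Real.cos (c * Real.sqrt (q (ℓ, 0) ^ 2 + q (ℓ, 1) ^ 2 + q (ℓ, 2) ^ 2)),
            c * Real.sinc (c * Real.sqrt (q (ℓ, 0) ^ 2 + q (ℓ, 1) ^ 2 + q (ℓ, 2) ^ 2)) * q (ℓ, 0),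
            c * Real.sinc (c * Real.sqrt (q (ℓ, 0) ^ 2 + q (ℓ, 1) ^ 2 + q (ℓ, 2) ^ 2)) * q (ℓ, 1),
            c * Real.sinc (c * Real.sqrt (q (ℓ, 0) ^ 2 + q (ℓ, 1) ^ 2 + q (ℓ, 2) ^ 2)) * q (ℓ, 2)]))
    (g₁ := g₁) (g₂ := g₂) (S := S) (T := fun q : (Edge d L × Fin 3) → ℝ => ∑ i, q i ^ 2 / 2)
    hJ hJm hF (fun q => su2Drift_neg c q) (measurable_su2Drift c) hg₁ hg₂ n hS
    measurable_piGaussianKinetic piGaussianWeight_univ_ne_zero_ne_top.1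
    piGaussianWeight_univ_ne_zero_ne_top.2

/-- **FT-HMC on the `SU(2)` rung with the engine's OMF4 integrator is exact.**  Any certified layer
`(F, J)`; Gaussian momenta; the 11-stage word with quaternion exponential drifts of ANY three
constants `c₁ c₂ c₃` (the code: `ρε`, `θε`, `(1−2(θ+ρ))ε`) and ANY three measurable forces; `n`
steps; flip; Metropolis; forget; report through `F`. -/
theorem su2_fthmc_omf4_gaussian_exact
    {F : GaugeConfig d L (Matrix.specialUnitaryGroup (Fin 2) ℂ) ≃ᵐ GaugeConfig d L (Matrix.specialUnitaryGroup (Fin 2) ℂ)} {J : GaugeConfig d L (Matrix.specialUnitaryGroup (Fin 2) ℂ) → ℝ}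
    (hJ : ∀ V, 0 < J V) (hJm : Measurable J)
    (hF : HasJacobian (Measure.pi fun _ : Edge d L => haarProbability (Matrix.specialUnitaryGroup (Fin 2) ℂ)) F
      fun V => ENNReal.ofReal (J V))
    {S : GaugeConfig d L (Matrix.specialUnitaryGroup (Fin 2) ℂ) → ℝ} (hS : Measurable S) (c₁ c₂ c₃ : ℝ)
    {gᵥ gₗ g_c : GaugeConfig d L (Matrix.specialUnitaryGroup (Fin 2) ℂ) → ((Edge d L × Fin 3) → ℝ)} (hgᵥ : Measurable gᵥ) (hgₗ : Measurable gₗ)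
    (hg_c : Measurable g_c) (n : ℕ) :
    Invariant
      (conjKernel
        (refreshUpdate
          (involMH
            (⇑((flip : Equiv.Perm (GaugeConfig d L (Matrix.specialUnitaryGroup (Fin 2) ℂ) × ((Edge d L × Fin 3) → ℝ))) *
                omf4Word gᵥ (mulDrift fun q : (Edge d L × Fin 3) → ℝ =>
                    fun ℓ : Edge d L => gaussUnit (toLp 2
          ![Real.cos (c₁ * Real.sqrt (q (ℓ, 0) ^ 2 + q (ℓ, 1) ^ 2 + q (ℓ, 2) ^ 2)),
            c₁ * Real.sinc (c₁ * Real.sqrt (q (ℓ, 0) ^ 2 + q (ℓ, 1) ^ 2 + q (ℓ, 2) ^ 2)) * q (ℓ, 0),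
            c₁ * Real.sinc (c₁ * Real.sqrt (q (ℓ, 0) ^ 2 + q (ℓ, 1) ^ 2 + q (ℓ, 2) ^ 2)) * q (ℓ, 1),
            c₁ * Real.sinc (c₁ * Real.sqrt (q (ℓ, 0) ^ 2 + q (ℓ, 1) ^ 2 + q (ℓ, 2) ^ 2)) * q (ℓ, 2)])) gₗ (mulDrift fun q : (Edge d L × Fin 3) → ℝ =>
                    fun ℓ : Edge d L => gaussUnit (toLp 2
          ![Real.cos (c₂ * Real.sqrt (q (ℓ, 0) ^ 2 + q (ℓ, 1) ^ 2 + q (ℓ, 2) ^ 2)),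
            c₂ * Real.sinc (c₂ * Real.sqrt (q (ℓ, 0) ^ 2 + q (ℓ, 1) ^ 2 + q (ℓ, 2) ^ 2)) * q (ℓ, 0),
            c₂ * Real.sinc (c₂ * Real.sqrt (q (ℓ, 0) ^ 2 + q (ℓ, 1) ^ 2 + q (ℓ, 2) ^ 2)) * q (ℓ, 1),
            c₂ * Real.sinc (c₂ * Real.sqrt (q (ℓ, 0) ^ 2 + q (ℓ, 1) ^ 2 + q (ℓ, 2) ^ 2)) * q (ℓ, 2)])) g_c (mulDrift fun q : (Edge d L × Fin 3) → ℝ =>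
                    fun ℓ : Edge d L => gaussUnit (toLp 2
          ![Real.cos (c₃ * Real.sqrt (q (ℓ, 0) ^ 2 + q (ℓ, 1) ^ 2 + q (ℓ, 2) ^ 2)),
            c₃ * Real.sinc (c₃ * Real.sqrt (q (ℓ, 0) ^ 2 + q (ℓ, 1) ^ 2 + q (ℓ, 2) ^ 2)) * q (ℓ, 0),
            c₃ * Real.sinc (c₃ * Real.sqrt (q (ℓ, 0) ^ 2 + q (ℓ, 1) ^ 2 + q (ℓ, 2) ^ 2)) * q (ℓ, 1),
            c₃ * Real.sinc (c₃ * Real.sqrt (q (ℓ, 0) ^ 2 + q (ℓ, 1) ^ 2 + q (ℓ, 2) ^ 2)) * q (ℓ, 2)])) ^ n))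
            (measurable_flip_omf4Word_pow (measurable_su2Drift c₁) (measurable_su2Drift c₂)
              (measurable_su2Drift c₃) hgᵥ hgₗ hg_c n)
            fun z : GaugeConfig d L (Matrix.specialUnitaryGroup (Fin 2) ℂ) × ((Edge d L × Fin 3) → ℝ) => (S (F z.1) - Real.log (J z.1)) + ∑ i, z.2 i ^ 2 / 2)
          ((((volume : Measure ((Edge d L × Fin 3) → ℝ)).withDensity
                  fun q => ENNReal.ofReal (Real.exp (-(∑ i, q i ^ 2 / 2)))) Set.univ)⁻¹ •
              (volume : Measure ((Edge d L × Fin 3) → ℝ)).withDensity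
                fun q => ENNReal.ofReal (Real.exp (-(∑ i, q i ^ 2 / 2)))))
        F)
      ((Measure.pi fun _ : Edge d L => haarProbability (Matrix.specialUnitaryGroup (Fin 2) ℂ)).withDensity
          fun U => ENNReal.ofReal (Real.exp (-S U))) := by
  haveI := isNegInvariant_volume_pi (Λ := Edge d L × Fin 3)
  exact gauge_fthmc_omf4_config_exact
    (μ := Measure.pi fun _ : Edge d L => haarProbability (Matrix.specialUnitaryGroup (Fin 2) ℂ))
    (ν := (volume : Measure ((Edge d L × Fin 3) → ℝ))) (F := F) (J := J)
    (e₁ := fun q : (Edge d L × Fin 3) → ℝ =>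
                    fun ℓ : Edge d L => gaussUnit (toLp 2
          ![Real.cos (c₁ * Real.sqrt (q (ℓ, 0) ^ 2 + q (ℓ, 1) ^ 2 + q (ℓ, 2) ^ 2)),
            c₁ * Real.sinc (c₁ * Real.sqrt (q (ℓ, 0) ^ 2 + q (ℓ, 1) ^ 2 + q (ℓ, 2) ^ 2)) * q (ℓ, 0),
            c₁ * Real.sinc (c₁ * Real.sqrt (q (ℓ, 0) ^ 2 + q (ℓ, 1) ^ 2 + q (ℓ, 2) ^ 2)) * q (ℓ, 1),
            c₁ * Real.sinc (c₁ * Real.sqrt (q (ℓ, 0) ^ 2 + q (ℓ, 1) ^ 2 + q (ℓ, 2) ^ 2)) * q (ℓ, 2)]))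
    (e₂ := fun q : (Edge d L × Fin 3) → ℝ =>
                    fun ℓ : Edge d L => gaussUnit (toLp 2
          ![Real.cos (c₂ * Real.sqrt (q (ℓ, 0) ^ 2 + q (ℓ, 1) ^ 2 + q (ℓ, 2) ^ 2)),
            c₂ * Real.sinc (c₂ * Real.sqrt (q (ℓ, 0) ^ 2 + q (ℓ, 1) ^ 2 + q (ℓ, 2) ^ 2)) * q (ℓ, 0),
            c₂ * Real.sinc (c₂ * Real.sqrt (q (ℓ, 0) ^ 2 + q (ℓ, 1) ^ 2 + q (ℓ, 2) ^ 2)) * q (ℓ, 1),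
            c₂ * Real.sinc (c₂ * Real.sqrt (q (ℓ, 0) ^ 2 + q (ℓ, 1) ^ 2 + q (ℓ, 2) ^ 2)) * q (ℓ, 2)]))
    (e₃ := fun q : (Edge d L × Fin 3) → ℝ =>
                    fun ℓ : Edge d L => gaussUnit (toLp 2
          ![Real.cos (c₃ * Real.sqrt (q (ℓ, 0) ^ 2 + q (ℓ, 1) ^ 2 + q (ℓ, 2) ^ 2)),
            c₃ * Real.sinc (c₃ * Real.sqrt (q (ℓ, 0) ^ 2 + q (ℓ, 1) ^ 2 + q (ℓ, 2) ^ 2)) * q (ℓ, 0),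
            c₃ * Real.sinc (c₃ * Real.sqrt (q (ℓ, 0) ^ 2 + q (ℓ, 1) ^ 2 + q (ℓ, 2) ^ 2)) * q (ℓ, 1),
            c₃ * Real.sinc (c₃ * Real.sqrt (q (ℓ, 0) ^ 2 + q (ℓ, 1) ^ 2 + q (ℓ, 2) ^ 2)) * q (ℓ, 2)]))
    (gᵥ := gᵥ) (gₗ := gₗ) (g_c := g_c) (S := S) (T := fun q : (Edge d L × Fin 3) → ℝ => ∑ i, q i ^ 2 / 2)
    hJ hJm hF (fun q => su2Drift_neg c₁ q) (fun q => su2Drift_neg c₂ q) (fun q => su2Drift_neg c₃ q)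
    (measurable_su2Drift c₁) (measurable_su2Drift c₂) (measurable_su2Drift c₃) hgᵥ hgₗ hg_c n hS
    measurable_piGaussianKinetic piGaussianWeight_univ_ne_zero_ne_top.1
    piGaussianWeight_univ_ne_zero_ne_top.2

end SU2

/-! ## Through the masked kick layers -/

section MaskedKick

variable {d L : ℕ} [NeZero L] (p : Edge d L → Prop) [DecidablePred p]

/-- **OMF2 FT-HMC through any masked `SU(2)` kick layer** (frozen measurable field `J` inside its
refusal rule; LO Wilson-flow sub-step and learned residual layers are instances) **is exact.** -/
theorem su2_fthmc_omf2_gaussian_exact_maskedKick {ε : ℝ}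
    (J : GaugeConfig d L (Matrix.specialUnitaryGroup (Fin 2) ℂ) → Edge d L → R4)
    (hJm : ∀ e, p e → Measurable fun V : GaugeConfig d L (Matrix.specialUnitaryGroup (Fin 2) ℂ) => J V e)
    (hJloc : ∀ V W : GaugeConfig d L (Matrix.specialUnitaryGroup (Fin 2) ℂ),
      (∀ j, ¬p j → V j = W j) → ∀ e, p e → J V e = J W e)
    (hκ : ∀ (V : GaugeConfig d L (Matrix.specialUnitaryGroup (Fin 2) ℂ)) (e : Edge d L), p e → |ε| * ‖J V e‖ < 1)
    {S : GaugeConfig d L (Matrix.specialUnitaryGroup (Fin 2) ℂ) → ℝ} (hS : Measurable S) (c : ℝ)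
    {g₁ g₂ : GaugeConfig d L (Matrix.specialUnitaryGroup (Fin 2) ℂ) → ((Edge d L × Fin 3) → ℝ)} (hg₁ : Measurable g₁) (hg₂ : Measurable g₂) (n : ℕ) :
    ∃ F : GaugeConfig d L (Matrix.specialUnitaryGroup (Fin 2) ℂ) ≃ᵐ GaugeConfig d L (Matrix.specialUnitaryGroup (Fin 2) ℂ),
      (⇑F = fun (V : GaugeConfig d L (Matrix.specialUnitaryGroup (Fin 2) ℂ)) (e : Edge d L) =>
        if p e then gaussUnit (geodesicKick ε (J V e)
          (vecQuat ((V e : Matrix.specialUnitaryGroup (Fin 2) ℂ) : Matrix (Fin 2) (Fin 2) ℂ)))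
        else V e) ∧
      Invariant
        (conjKernel
          (refreshUpdate
            (involMH
              (⇑((flip : Equiv.Perm (GaugeConfig d L (Matrix.specialUnitaryGroup (Fin 2) ℂ) × ((Edge d L × Fin 3) → ℝ))) *
                  omf2Word g₁ (mulDrift fun q : (Edge d L × Fin 3) → ℝ =>
                    fun ℓ : Edge d L => gaussUnit (toLp 2
          ![Real.cos (c * Real.sqrt (q (ℓ, 0) ^ 2 + q (ℓ, 1) ^ 2 + q (ℓ, 2) ^ 2)),
            c * Real.sinc (c * Real.sqrt (q (ℓ, 0) ^ 2 + q (ℓ, 1) ^ 2 + q (ℓ, 2) ^ 2)) * q (ℓ, 0),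
            c * Real.sinc (c * Real.sqrt (q (ℓ, 0) ^ 2 + q (ℓ, 1) ^ 2 + q (ℓ, 2) ^ 2)) * q (ℓ, 1),
            c * Real.sinc (c * Real.sqrt (q (ℓ, 0) ^ 2 + q (ℓ, 1) ^ 2 + q (ℓ, 2) ^ 2)) * q (ℓ, 2)])) g₂ ^ n))
              (measurable_flip_omf2Word_pow (measurable_su2Drift c) hg₁ hg₂ n)
              fun z : GaugeConfig d L (Matrix.specialUnitaryGroup (Fin 2) ℂ) × ((Edge d L × Fin 3) → ℝ) =>
                (S (F z.1) - Real.log (∏ a : {e : Edge d L // p e},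
                  (if Real.sin (angle (J z.1 a.1) (vecQuat ((z.1 a.1 : Matrix.specialUnitaryGroup (Fin 2) ℂ) : Matrix (Fin 2) (Fin 2) ℂ))) = 0 then
                      (1 - ε * ‖J z.1 a.1‖ * Real.cos (angle (J z.1 a.1) (vecQuat ((z.1 a.1 : Matrix.specialUnitaryGroup (Fin 2) ℂ) : Matrix (Fin 2) (Fin 2) ℂ)))) ^ 3
                    else kickJac (ε * ‖J z.1 a.1‖) 2 (angle (J z.1 a.1) (vecQuat ((z.1 a.1 : Matrix.specialUnitaryGroup (Fin 2) ℂ) : Matrix (Fin 2) (Fin 2) ℂ)))))) + ∑ i, z.2 i ^ 2 / 2)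
            ((((volume : Measure ((Edge d L × Fin 3) → ℝ)).withDensity
                  fun q => ENNReal.ofReal (Real.exp (-(∑ i, q i ^ 2 / 2)))) Set.univ)⁻¹ •
              (volume : Measure ((Edge d L × Fin 3) → ℝ)).withDensity
                fun q => ENNReal.ofReal (Real.exp (-(∑ i, q i ^ 2 / 2)))))
          F)
        ((Measure.pi fun _ : Edge d L => haarProbability (Matrix.specialUnitaryGroup (Fin 2) ℂ)).withDensity
          fun U => ENNReal.ofReal (Real.exp (-S U))) := by
  obtain ⟨F, hF, hJ, hpos, hJm'⟩ := exists_measurableEquiv_su2MaskedKick p J hJm hJloc hκ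
  exact ⟨F, hF, su2_fthmc_omf2_gaussian_exact hpos hJm' hJ hS c hg₁ hg₂ n⟩

/-- **OMF4 FT-HMC through any masked `SU(2)` kick layer is exact.** -/
theorem su2_fthmc_omf4_gaussian_exact_maskedKick {ε : ℝ}
    (J : GaugeConfig d L (Matrix.specialUnitaryGroup (Fin 2) ℂ) → Edge d L → R4)
    (hJm : ∀ e, p e → Measurable fun V : GaugeConfig d L (Matrix.specialUnitaryGroup (Fin 2) ℂ) => J V e)
    (hJloc : ∀ V W : GaugeConfig d L (Matrix.specialUnitaryGroup (Fin 2) ℂ),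
      (∀ j, ¬p j → V j = W j) → ∀ e, p e → J V e = J W e)
    (hκ : ∀ (V : GaugeConfig d L (Matrix.specialUnitaryGroup (Fin 2) ℂ)) (e : Edge d L), p e → |ε| * ‖J V e‖ < 1)
    {S : GaugeConfig d L (Matrix.specialUnitaryGroup (Fin 2) ℂ) → ℝ} (hS : Measurable S) (c₁ c₂ c₃ : ℝ)
    {gᵥ gₗ g_c : GaugeConfig d L (Matrix.specialUnitaryGroup (Fin 2) ℂ) → ((Edge d L × Fin 3) → ℝ)} (hgᵥ : Measurable gᵥ) (hgₗ : Measurable gₗ)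
    (hg_c : Measurable g_c) (n : ℕ) :
    ∃ F : GaugeConfig d L (Matrix.specialUnitaryGroup (Fin 2) ℂ) ≃ᵐ GaugeConfig d L (Matrix.specialUnitaryGroup (Fin 2) ℂ),
      (⇑F = fun (V : GaugeConfig d L (Matrix.specialUnitaryGroup (Fin 2) ℂ)) (e : Edge d L) =>
        if p e then gaussUnit (geodesicKick ε (J V e)
          (vecQuat ((V e : Matrix.specialUnitaryGroup (Fin 2) ℂ) : Matrix (Fin 2) (Fin 2) ℂ)))
        else V e) ∧
      Invariant
        (conjKernel
          (refreshUpdate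
            (involMH
              (⇑((flip : Equiv.Perm (GaugeConfig d L (Matrix.specialUnitaryGroup (Fin 2) ℂ) × ((Edge d L × Fin 3) → ℝ))) *
                  omf4Word gᵥ (mulDrift fun q : (Edge d L × Fin 3) → ℝ =>
                    fun ℓ : Edge d L => gaussUnit (toLp 2
          ![Real.cos (c₁ * Real.sqrt (q (ℓ, 0) ^ 2 + q (ℓ, 1) ^ 2 + q (ℓ, 2) ^ 2)),
            c₁ * Real.sinc (c₁ * Real.sqrt (q (ℓ, 0) ^ 2 + q (ℓ, 1) ^ 2 + q (ℓ, 2) ^ 2)) * q (ℓ, 0),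
            c₁ * Real.sinc (c₁ * Real.sqrt (q (ℓ, 0) ^ 2 + q (ℓ, 1) ^ 2 + q (ℓ, 2) ^ 2)) * q (ℓ, 1),
            c₁ * Real.sinc (c₁ * Real.sqrt (q (ℓ, 0) ^ 2 + q (ℓ, 1) ^ 2 + q (ℓ, 2) ^ 2)) * q (ℓ, 2)])) gₗ (mulDrift fun q : (Edge d L × Fin 3) → ℝ =>
                    fun ℓ : Edge d L => gaussUnit (toLp 2
          ![Real.cos (c₂ * Real.sqrt (q (ℓ, 0) ^ 2 + q (ℓ, 1) ^ 2 + q (ℓ, 2) ^ 2)),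
            c₂ * Real.sinc (c₂ * Real.sqrt (q (ℓ, 0) ^ 2 + q (ℓ, 1) ^ 2 + q (ℓ, 2) ^ 2)) * q (ℓ, 0),
            c₂ * Real.sinc (c₂ * Real.sqrt (q (ℓ, 0) ^ 2 + q (ℓ, 1) ^ 2 + q (ℓ, 2) ^ 2)) * q (ℓ, 1),
            c₂ * Real.sinc (c₂ * Real.sqrt (q (ℓ, 0) ^ 2 + q (ℓ, 1) ^ 2 + q (ℓ, 2) ^ 2)) * q (ℓ, 2)])) g_c (mulDrift fun q : (Edge d L × Fin 3) → ℝ =>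
                    fun ℓ : Edge d L => gaussUnit (toLp 2
          ![Real.cos (c₃ * Real.sqrt (q (ℓ, 0) ^ 2 + q (ℓ, 1) ^ 2 + q (ℓ, 2) ^ 2)),
            c₃ * Real.sinc (c₃ * Real.sqrt (q (ℓ, 0) ^ 2 + q (ℓ, 1) ^ 2 + q (ℓ, 2) ^ 2)) * q (ℓ, 0),
            c₃ * Real.sinc (c₃ * Real.sqrt (q (ℓ, 0) ^ 2 + q (ℓ, 1) ^ 2 + q (ℓ, 2) ^ 2)) * q (ℓ, 1),
            c₃ * Real.sinc (c₃ * Real.sqrt (q (ℓ, 0) ^ 2 + q (ℓ, 1) ^ 2 + q (ℓ, 2) ^ 2)) * q (ℓ, 2)])) ^ n))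
              (measurable_flip_omf4Word_pow (measurable_su2Drift c₁) (measurable_su2Drift c₂)
                (measurable_su2Drift c₃) hgᵥ hgₗ hg_c n)
              fun z : GaugeConfig d L (Matrix.specialUnitaryGroup (Fin 2) ℂ) × ((Edge d L × Fin 3) → ℝ) =>
                (S (F z.1) - Real.log (∏ a : {e : Edge d L // p e},
                  (if Real.sin (angle (J z.1 a.1) (vecQuat ((z.1 a.1 : Matrix.specialUnitaryGroup (Fin 2) ℂ) : Matrix (Fin 2) (Fin 2) ℂ))) = 0 then
                      (1 - ε * ‖J z.1 a.1‖ * Real.cos (angle (J z.1 a.1) (vecQuat ((z.1 a.1 : Matrix.specialUnitaryGroup (Fin 2) ℂ) : Matrix (Fin 2) (Fin 2) ℂ)))) ^ 3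
                    else kickJac (ε * ‖J z.1 a.1‖) 2 (angle (J z.1 a.1) (vecQuat ((z.1 a.1 : Matrix.specialUnitaryGroup (Fin 2) ℂ) : Matrix (Fin 2) (Fin 2) ℂ)))))) + ∑ i, z.2 i ^ 2 / 2)
            ((((volume : Measure ((Edge d L × Fin 3) → ℝ)).withDensity
                  fun q => ENNReal.ofReal (Real.exp (-(∑ i, q i ^ 2 / 2)))) Set.univ)⁻¹ •
              (volume : Measure ((Edge d L × Fin 3) → ℝ)).withDensity
                fun q => ENNReal.ofReal (Real.exp (-(∑ i, q i ^ 2 / 2)))))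
          F)
        ((Measure.pi fun _ : Edge d L => haarProbability (Matrix.specialUnitaryGroup (Fin 2) ℂ)).withDensity
          fun U => ENNReal.ofReal (Real.exp (-S U))) := by
  obtain ⟨F, hF, hJ, hpos, hJm'⟩ := exists_measurableEquiv_su2MaskedKick p J hJm hJloc hκ
  exact ⟨F, hF, su2_fthmc_omf4_gaussian_exact hpos hJm' hJ hS c₁ c₂ c₃ hgᵥ hgₗ hg_c n⟩

end MaskedKick

end Summit.Ventures.LatticeQCDFlow.Exactness
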